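import Literature.MathematicalPhysics.QuantumFieldTheory.Balaban1983to89.Beta.AdjointTransportJets
import Literature.MathematicalPhysics.QuantumFieldTheory.Balaban1983to89.Beta.AveragingContours

/-!
# `Balaban1983to89.Beta.TransportedContourVariables` — Bałaban's transported contour variables
`(R_{0,y}V′)(Γ)` (B7 (58)) at the letter level: the factorisation `V(Γ) = (R_{0,y}V′)(Γ)·V₀(Γ)`, the
linearisation `(R_{0,y}A)(Γ)` («the product over b replaced by the sum»), and its BACKGROUND JETS for
`V₀ = e^{tB}` — the mixed ordered commutators `Σ_{i<j} [B_i, A_j]` of the (V-H) main-term vertex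

HONEST FRAMING (page 1, binding for the whole β sub-cell).  Discharging `FlowStep.BetaPertH` would make Bałaban's
ultraviolet stability of 4-d lattice Yang–Mills UNCONDITIONAL inside this package — a real constructive-QFT result; it
is NOT the continuum limit and NOT the Clay Millennium problem.  This module is one typed brick of the (V-H) stencil
(the `B`-jets of Bałaban's linearised one-step vector averaging `Q(V₀)`, B7 (124)/(125), B9 (3.14)–(3.15)); it is
kernel mathematics about finite lists of letters in a complete normed algebra and asserts NOTHING printed in the papers
under audit.  ABSOLUTE RULE: no internally-minted statement enters as a cited fact; the manuscripts under audit
(B7 = [Balaban1985Averaging], B9 = [Balaban1985BackgroundPropagators]) are quoted below only to say WHICH object is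
being typed — every quotation was re-read for this module from the page renders
`b2b-balaban-ref1/pages/1985-cmp98-averaging/1985-cmp98-averaging-p011-x2.png` (B7 p. 27; journal page = PDF page + 16),
`-p012-x2.png` (p. 28), `-p015-x2.png` (p. 31), and `…/1985-cmp99-background-propagators/…-p002/p004/p005-x2.png` (B9 pp. 390, 392, 393;
journal page = PDF page + 388), READ AS IMAGES (2026-08-19).

WHAT IS PRINTED (verbatim).
* B7 p. 27 (55)–(56): «V′^v_b = v(b₋)V′_b R(V_{0,b})v^{−1}(b₊) = v(b₋)V′_b R_{0,b}v^{−1}(b₊), (55) where for arbitrary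
  invertible matrix X the operator R(X) is given by the formula R(X)Y = XYX^{−1}. (56)»; above it: «We will consider
  gauge field configurations V of the form V = V′V₀, where V₀ is a fixed configuration and V′ may have values in the
  complexified group G^c.»; (57): «R(X)R(Y) = R(XY), R(X)^{−1} = R(X^{−1})»; (58): «(R_{0,y}V′)(Γ_{y,x}) =
  Π_{b⊂Γ_{y,x}} R(V₀(Γ_{y,b₋}))V′_b = 1, x ∈ B(y), x ≠ y. (58)»; «(R_{0,y}v)(x) = R(V₀(Γ_{y,x}))v(x)».
* B7 p. 28 (render `-p012-x2.png`, read as image; the display after (60), before (61) — the READING of `R_{0,c₋}` on a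
  straight segment): «Because of the axial gauge conditions (58), the average (V′V₀)‾_c depends on
  (R_{0,c₋}V′)([x, x(c)]) = Π_{b⊂[x,x(c)]} R(V₀(Γ_{c₋,x}∪[x, b₋]))V′_b, x ∈ B(c₋), and a good approximation of the
  function (1/i) log(V′V₀)‾_c(V̄₀)_c^{−1} for V′ = e^{iA}, A small, is given by (Q₀A)(c) = Σ_{x∈B(c₋)}
  L^{−d}(R_{0,c₋}A)([x, x(c)]), where R_{0,c₋}A is defined as R_{0,c₋}V′, only the product over b is replaced by the
  sum.» (the same display is quoted in b08's `B7Eq61Linearization` header; it is re-read here, not re-used).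
* B7 p. 31 (89)–(90): «(R(V₀)V₁)‾_c = (R_{0,c₋}V₁)‾^{−1}(V₁V₀)‾_c(V̄₀)_c^{−1}R̄_{0,c}R_{0,c₊}V₁‾ … (89)», «U̿₁ = R(U₀)U₁‾ (90)».
* B7 p. 36 (125) (quoted in node 4 `Beta.AveragingCorrectionJets` and in b07's `B7Prop3Flat`): «(Q₀A)_c = (Q_{V₀}A)_c =
  Σ_{x∈B(c₋)} L^{−(d+1)}(R_{0,c₋}A)([x, x′]), (125)» — the MAIN TERM of the five-term linear form (124).
* B9 p. 390: «Let us recall that R(U)X = UXU^{−1}.»; p. 392–393 (3.13)–(3.15): «Q_j(U, ηA) = (1/i) log (exp iηA)‾^j (3.13)»,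
  «(1/(L^jη)) Q_j(U, ηA) = Q_j(U)A + (1/(L^jη)) C_j(U, L^jηA), (3.14) where Q_j(U)A is a linear part of the function (3.13)»,
  «Q_j(U) = Q(Ū^{j−1})·…·Q(Ū)Q(U), (3.15) where Q(V) is given by the explicit formula (124) in [5].»

WHAT IS TYPED (letters, colour-free; `𝔸` a complete normed `𝕜`-algebra, `𝕜 = ℝ` or `ℂ`; the `i`'s of `e^{iA}`, `e^{iB}`
absorbed into the letters).  A contour `Γ` met by a BACKGROUND one-form `B` and a FLUCTUATION one-form `A` is the list
of letter PAIRS `l = [(B₁, A₁), …, (B_n, A_n)]` (the values of `B` and `A` on the successive oriented bonds of `Γ`,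
backward bonds negated — node 5 `Beta.AveragingContours` supplies these lists for Bałaban's `Γ_{y,x}`, `[x, x′]`,
`Γ_{c,x}`).  With `V₀ = e^{tB}`, `V′ = e^{sA}` bondwise and `V = V′V₀` ((55): fluctuation LEFT of background):
§1 ALGEBRA OF THE VERTEX LETTERS.  `mixedComm l = Σ_{i<j} (B_i A_j − A_j B_i)` (recursively `mixedComm ((b,a)::l) =
   mixedComm l + [b, Σ_j A_j]`) and the second-jet word `mixedJet₂ l` (recursively `+ 2[b, mixedComm l] + [b,[b, Σ A]]`);
   `mixedComm` of the diagonal list `(b_j, b_j)` is an2's `commSum` (`mixedComm_diag`); concatenation law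
   `mixedComm_append` (the cross term `[Σ B(l₁), Σ A(l₂)]`); no background or no fluctuation ⇒ no vertex.
§2 THE TRANSPORTED CONTOUR SUM `(R_{0,y}A)(Γ)` for `V₀ = e^{tB}`: `transSum l t`, recursively
   `transSum ((b,a)::l) t = a + e^{tb}·(transSum l t)·e^{−tb}` — each fluctuation letter is adjoint-transported back to
   the initial point along the PREFIX of the contour preceding its bond ((58): along `Γ_{y,b₋}`; p. 28: along
   `Γ_{c₋,x}∪[x, b₋]`); `transSum_append`/`transSum_append_single` = the printed product-over-prefix shape by name of
   node 3's `conjPath`; at `t = 0` it is the plain letter sum (`transSum_zero`).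
§3 ITS BACKGROUND JETS (the point of the module): `t ↦ transSum l t` is differentiable with Leibniz-form derivatives
   `transD₁`, `transD₂` at every `t` (`hasDerivAt_transSum`, `hasDerivAt_transD₁`), and AT `t = 0`:
   FIRST JET `= mixedComm l = Σ_{i<j}[B_i, A_j]` (`transD₁_zero`, `hasDerivAt_transSum_zero`), SECOND JET `= mixedJet₂ l`
   (`transD₂_zero`, `hasDerivAt_transD₁_zero`).  These are the letters of the FIRST and SECOND `B`-jets of the main term
   (125) of `Q(e^{tB})` — the (V-H) vertex of the one-loop vacuum polarisation in Bałaban's own averaging.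
§4 THE GROUP-LEVEL FACTORISATION behind (58): with `pairHol l s t = Π_j e^{sA_j}e^{tB_j}` (`= V(Γ)`, `V = V′V₀`) and
   `transHol l s t = Π_j R(V₀(prefix_j))e^{sA_j}` (`= (R_{0,y}V′)(Γ)`): `pairHol = transHol · holPath(B)` EXACTLY
   (`pairHol_eq_transHol_mul_holPath`), `transHol l 0 t = 1`, and THE LINEARISATION IN THE FLUCTUATION
   `∂_s|₀ transHol l s t = transSum l t` (`hasDerivAt_transHol_zero`) — «only the product over b is replaced by the sum»,
   kernel-checked.
§5 TRACES AND SIZES: `τ(transSum l t) = τ(Σ A)` for tracial `τ` (transport is invisible to the colour trace), both jet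
   words are traceless (`trace_mixedComm`, `trace_mixedJet₂`), and `‖mixedComm l‖ ≤ 2·size(B)·size(A)`,
   `‖mixedJet₂ l‖ ≤ 4·size(B)²·size(A)` (uniform in the number of bonds, in an2's `TransportVertices.size`).
§6 ON BAŁABAN'S CONTOURS (node 5 by name): naturality of the node-5 letter lists under additive maps (`segUp_map`, …,
   `gammaC_map`, `loopC_map`), the pair form `pairForm B A`, and the two transported objects of (58)/(125):
   `transAxial B A y x t = (R_{0,y}A)(Γ_{y,x})` and `transMain B A L μ y b t = (R_{0,c₋}A)([x, x′])`, `x = L·y + b`,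
   `x′ = x + L e_μ`, the latter LITERALLY in the p. 28 shape `R(V₀(Γ_{c₋,x}))·[prefix-transported segment sum]`
   (`transSum_axial_append_segUp`); at `t = 0` the block sum of `transMain` is node 5's `straightSum` ((125) at the flat
   background = [Balaban1984PropagatorsI] (1.11), cf. b07's `B7Prop3Flat`: «(124) REDUCES TO ITS FIRST TERM (125)»), and
   its FIRST `B`-JET is `[B(Γ_{c₋,x}), A([x,x′])] + Σ_{i<j⊂[x,x′]}[B_i, A_j]` (`hasDerivAt_transMain_zero`).

RELATION TO THE TREE (nothing restated, nothing imported from the paper sub-cells).  b08's `B7Eq61Linearization` types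
the same p. 28 display with FREE transporters (`lineRA L T R A x μ`, `Q0`, the gauge variation `Q0_gauge`, the loop
defect); b07's `B7Prop1Explicit`/`B7Prop3Flat` type the average (42), the words `Γ` as direction lists and Proposition 3
at the FLAT background `V₀ = 1`.  What is new here is the ONE-PARAMETER BACKGROUND FAMILY `V₀ = e^{tB}` and its jets at
`t = 0`, on top of an2's `Beta.TransportVertices` (`holPath`, `D₁`, `hasDerivAt_holPath`, `D₁_zero`, `size`, `commSum`)
and node 3 `Beta.AdjointTransportJets` (`invPath`, `conjPath`, `holPath_mul_inv`, `holPath_inv_mul`, `sum_inv`) — used BY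
NAME.  NOT HERE: the 2nd–5th terms of (124) (their jet SHAPES are node 4 `Beta.AveragingCorrectionJets` + node 4b
`Beta.LogHolonomySecondJet`), the averaged bond transporter `R̄_{0,c} = R((V̄₀)_c)` of (59)/(124), the composition (3.15),
colour coordinates / `JetData` packaging (an2's `Beta.OneStepResolventKernel`), and the second `B`-jet of `transMain`.

Provenance: b2b-balaban β sub-cell, unit beta-an1 gen 10 (node 6), 2026-08-19.  Bib keys: Balaban1985Averaging,
Balaban1985BackgroundPropagators, Balaban1984PropagatorsI.
-/

noncomputable section

open NormedSpace Finset

namespace Literature.MathematicalPhysics.QuantumFieldTheory.Balaban1983to89.Beta.TransportedContourVariables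

open Literature.MathematicalPhysics.QuantumFieldTheory.Balaban1983to89.Beta.TransportVertices
open Literature.MathematicalPhysics.QuantumFieldTheory.Balaban1983to89.Beta.AdjointTransportJets
open Literature.MathematicalPhysics.QuantumFieldTheory.Balaban1983to89.Beta.AffineAveraging
open Literature.MathematicalPhysics.QuantumFieldTheory.Balaban1983to89.Beta.AveragingContours

/-! ## §1  The vertex letters: mixed ordered commutators -/

section Letters

variable {α β : Type*}

/-- [folklore] The BACKGROUND letters of a list of letter pairs. -/
def bg (l : List (α × β)) : List α := l.map Prod.fst

/-- [folklore] The FLUCTUATION letters of a list of letter pairs. -/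
def fl (l : List (α × β)) : List β := l.map Prod.snd

/-- [folklore] `bg [] = []`. -/
@[simp] theorem bg_nil : bg ([] : List (α × β)) = [] := rfl

/-- [folklore] `bg (p :: l) = p.1 :: bg l`. -/
@[simp] theorem bg_cons (p : α × β) (l : List (α × β)) : bg (p :: l) = p.1 :: bg l := rfl

/-- [folklore] `fl [] = []`. -/
@[simp] theorem fl_nil : fl ([] : List (α × β)) = [] := rfl

/-- [folklore] `fl (p :: l) = p.2 :: fl l`. -/
@[simp] theorem fl_cons (p : α × β) (l : List (α × β)) : fl (p :: l) = p.2 :: fl l := rfl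

/-- [folklore] `bg (l₁ ++ l₂) = bg l₁ ++ bg l₂`. -/
@[simp] theorem bg_append (l₁ l₂ : List (α × β)) : bg (l₁ ++ l₂) = bg l₁ ++ bg l₂ := by
  simp [bg]

/-- [folklore] `fl (l₁ ++ l₂) = fl l₁ ++ fl l₂`. -/
@[simp] theorem fl_append (l₁ l₂ : List (α × β)) : fl (l₁ ++ l₂) = fl l₁ ++ fl l₂ := by
  simp [fl]

/-- [folklore] `|bg l| = |l|`. -/
@[simp] theorem bg_length (l : List (α × β)) : (bg l).length = l.length := by
  simp [bg]

/-- [folklore] `|fl l| = |l|`. -/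
@[simp] theorem fl_length (l : List (α × β)) : (fl l).length = l.length := by
  simp [fl]

/-- [folklore] The diagonal list has both projections equal to the list. -/
@[simp] theorem bg_diag (l : List α) : bg (l.map fun b => (b, b)) = l := by
  simp [bg, Function.comp_def]

/-- [folklore] The diagonal list has both projections equal to the list. -/
@[simp] theorem fl_diag (l : List α) : fl (l.map fun b => (b, b)) = l := by
  simp [fl, Function.comp_def]

end Letters

section Algebra

variable {𝔸 : Type*} [NormedRing 𝔸]

/-- [folklore] THE FIRST-JET WORD: the mixed ordered commutator sum `Σ_{i<j} (B_i A_j − A_j B_i)` — every fluctuation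
letter commutated with the background letters PRECEDING it on the contour (recursively: the head background letter
against the sum of all later fluctuation letters). -/
def mixedComm : List (𝔸 × 𝔸) → 𝔸
  | [] => 0
  | p :: l => mixedComm l + (p.1 * (fl l).sum - (fl l).sum * p.1)

/-- [folklore] `mixedComm [] = 0`. -/
@[simp] theorem mixedComm_nil : mixedComm ([] : List (𝔸 × 𝔸)) = 0 := rfl

/-- [folklore] `mixedComm ((b,a) :: l) = mixedComm l + (b·ΣA(l) − ΣA(l)·b)`. -/
@[simp] theorem mixedComm_cons (p : 𝔸 × 𝔸) (l : List (𝔸 × 𝔸)) :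
    mixedComm (p :: l) = mixedComm l + (p.1 * (fl l).sum - (fl l).sum * p.1) := rfl

/-- [folklore] THE SECOND-JET WORD (recursively: `+ 2[b, mixedComm l] + [b, [b, ΣA(l)]]`). -/
def mixedJet₂ : List (𝔸 × 𝔸) → 𝔸
  | [] => 0
  | p :: l => mixedJet₂ l + 2 • (p.1 * mixedComm l - mixedComm l * p.1)
      + (p.1 * (p.1 * (fl l).sum - (fl l).sum * p.1) - (p.1 * (fl l).sum - (fl l).sum * p.1) * p.1)

/-- [folklore] `mixedJet₂ [] = 0`. -/
@[simp] theorem mixedJet₂_nil : mixedJet₂ ([] : List (𝔸 × 𝔸)) = 0 := rfl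

/-- [folklore] The recursion of `mixedJet₂`. -/
@[simp] theorem mixedJet₂_cons (p : 𝔸 × 𝔸) (l : List (𝔸 × 𝔸)) :
    mixedJet₂ (p :: l) = mixedJet₂ l + 2 • (p.1 * mixedComm l - mixedComm l * p.1)
      + (p.1 * (p.1 * (fl l).sum - (fl l).sum * p.1) - (p.1 * (fl l).sum - (fl l).sum * p.1) * p.1) := rfl

/-- [folklore] ON THE DIAGONAL (background = fluctuation) the first-jet word is an2's path-ordering word
`TransportVertices.commSum`. -/
theorem mixedComm_diag (l : List 𝔸) : mixedComm (l.map fun b => (b, b)) = commSum l := by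
  induction l with
  | nil => simp
  | cons b l ih => simp [ih]

/-- [folklore] CONCATENATED CONTOURS: `mixedComm (l₁ ++ l₂) = mixedComm l₁ + mixedComm l₂ + [ΣB(l₁), ΣA(l₂)]` — every
fluctuation letter of the second piece sees the whole background circulation of the first piece. -/
theorem mixedComm_append (l₁ l₂ : List (𝔸 × 𝔸)) :
    mixedComm (l₁ ++ l₂) = mixedComm l₁ + mixedComm l₂
      + ((bg l₁).sum * (fl l₂).sum - (fl l₂).sum * (bg l₁).sum) := by
  induction l₁ with
  | nil => simp
  | cons p l₁ ih =>
    simp only [List.cons_append, mixedComm_cons, ih, fl_append, List.sum_append, bg_cons, List.sum_cons]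
    noncomm_ring

/-- [folklore] Appending one bond: its fluctuation letter is commutated with the full preceding background circulation. -/
theorem mixedComm_append_single (l : List (𝔸 × 𝔸)) (p : 𝔸 × 𝔸) :
    mixedComm (l ++ [p]) = mixedComm l + ((bg l).sum * p.2 - p.2 * (bg l).sum) := by
  rw [mixedComm_append]
  simp [fl]

/-- [folklore] NO BACKGROUND ⇒ NO VERTEX. -/
theorem mixedComm_eq_zero_of_bg (l : List (𝔸 × 𝔸)) (h : ∀ p ∈ l, p.1 = 0) : mixedComm l = 0 := by
  induction l with
  | nil => simp
  | cons p l ih =>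
    have hp : p.1 = 0 := h p (by simp)
    have hl : ∀ q ∈ l, q.1 = 0 := fun q hq => h q (by simp [hq])
    simp [ih hl, hp]

/-- [folklore] NO FLUCTUATION ⇒ NO VERTEX. -/
theorem mixedComm_eq_zero_of_fl (l : List (𝔸 × 𝔸)) (h : ∀ p ∈ l, p.2 = 0) : mixedComm l = 0 := by
  induction l with
  | nil => simp
  | cons p l ih =>
    have hl : ∀ q ∈ l, q.2 = 0 := fun q hq => h q (by simp [hq])
    have hs : (fl l).sum = 0 := by
      apply List.sum_eq_zero
      intro a ha
      simp only [fl, List.mem_map] at ha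
      obtain ⟨q, hq, rfl⟩ := ha
      exact hl q hq
    simp [ih hl, hs]

/-- [folklore] TRACIAL FUNCTIONALS KILL THE FIRST-JET WORD (it is a sum of commutators). -/
theorem trace_mixedComm {V : Type*} [AddCommGroup V] (τ : 𝔸 →+ V) (hτ : ∀ a b : 𝔸, τ (a * b) = τ (b * a))
    (l : List (𝔸 × 𝔸)) : τ (mixedComm l) = 0 := by
  induction l with
  | nil => simp
  | cons p l ih => rw [mixedComm_cons, map_add, ih, map_sub, hτ, sub_self, add_zero]

/-- [folklore] TRACIAL FUNCTIONALS KILL THE SECOND-JET WORD. -/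
theorem trace_mixedJet₂ {V : Type*} [AddCommGroup V] (τ : 𝔸 →+ V) (hτ : ∀ a b : 𝔸, τ (a * b) = τ (b * a))
    (l : List (𝔸 × 𝔸)) : τ (mixedJet₂ l) = 0 := by
  induction l with
  | nil => simp
  | cons p l ih =>
    have h1 : τ (p.1 * mixedComm l - mixedComm l * p.1) = 0 := by rw [map_sub, hτ, sub_self]
    have h2 : τ (p.1 * (p.1 * (fl l).sum - (fl l).sum * p.1) - (p.1 * (fl l).sum - (fl l).sum * p.1) * p.1)
        = 0 := by rw [map_sub, hτ, sub_self]
    rw [mixedJet₂_cons, map_add, map_add, ih, map_nsmul, h1, h2, smul_zero, add_zero, add_zero]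

/-- [folklore] SIZE OF THE FIRST-JET WORD, uniform in the number of bonds: `‖Σ_{i<j}[B_i, A_j]‖ ≤ 2·size(B)·size(A)`. -/
theorem norm_mixedComm_le (l : List (𝔸 × 𝔸)) : ‖mixedComm l‖ ≤ 2 * size (bg l) * size (fl l) := by
  induction l with
  | nil => simp
  | cons p l ih =>
    rw [mixedComm_cons, bg_cons, fl_cons, size_cons, size_cons]
    have hS := norm_sum_le_size (fl l)
    have hb := size_nonneg (bg l)
    have hf := size_nonneg (fl l)
    have h0 : 0 ≤ ‖p.1‖ := norm_nonneg _
    have h2 : 0 ≤ ‖p.2‖ := norm_nonneg _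
    calc ‖mixedComm l + (p.1 * (fl l).sum - (fl l).sum * p.1)‖
        ≤ ‖mixedComm l‖ + (‖p.1‖ * ‖(fl l).sum‖ + ‖(fl l).sum‖ * ‖p.1‖) :=
          (norm_add_le _ _).trans (by
            gcongr
            exact (norm_sub_le _ _).trans (add_le_add (norm_mul_le _ _) (norm_mul_le _ _)))
      _ ≤ 2 * size (bg l) * size (fl l) + (‖p.1‖ * size (fl l) + size (fl l) * ‖p.1‖) := by gcongr
      _ ≤ 2 * (‖p.1‖ + size (bg l)) * (‖p.2‖ + size (fl l)) := by
          nlinarith [mul_nonneg h0 h2, mul_nonneg hb h2, mul_nonneg h0 hf]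

/-- [folklore] SIZE OF THE SECOND-JET WORD, uniform in the number of bonds: `‖mixedJet₂ l‖ ≤ 4·size(B)²·size(A)`. -/
theorem norm_mixedJet₂_le (l : List (𝔸 × 𝔸)) : ‖mixedJet₂ l‖ ≤ 4 * size (bg l) ^ 2 * size (fl l) := by
  induction l with
  | nil => simp
  | cons p l ih =>
    rw [mixedJet₂_cons, bg_cons, fl_cons, size_cons, size_cons]
    have hS := norm_sum_le_size (fl l)
    have hM := norm_mixedComm_le l
    have hb := size_nonneg (bg l)
    have hf := size_nonneg (fl l)
    have h0 : 0 ≤ ‖p.1‖ := norm_nonneg _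
    have h2 : 0 ≤ ‖p.2‖ := norm_nonneg _
    have hX : ‖p.1 * (fl l).sum - (fl l).sum * p.1‖ ≤ 2 * ‖p.1‖ * size (fl l) := by
      calc ‖p.1 * (fl l).sum - (fl l).sum * p.1‖ ≤ ‖p.1‖ * ‖(fl l).sum‖ + ‖(fl l).sum‖ * ‖p.1‖ :=
            (norm_sub_le _ _).trans (add_le_add (norm_mul_le _ _) (norm_mul_le _ _))
        _ ≤ ‖p.1‖ * size (fl l) + size (fl l) * ‖p.1‖ := by gcongr
        _ = 2 * ‖p.1‖ * size (fl l) := by ring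
    have hT2 : ‖(2 : ℕ) • (p.1 * mixedComm l - mixedComm l * p.1)‖ ≤ 2 * (2 * ‖p.1‖ * ‖mixedComm l‖) := by
      calc ‖(2 : ℕ) • (p.1 * mixedComm l - mixedComm l * p.1)‖ ≤ 2 * ‖p.1 * mixedComm l - mixedComm l * p.1‖ := by
            simpa using (norm_nsmul_le : ‖(2 : ℕ) • (p.1 * mixedComm l - mixedComm l * p.1)‖
              ≤ ((2 : ℕ) : ℝ) * ‖p.1 * mixedComm l - mixedComm l * p.1‖)
        _ ≤ 2 * (2 * ‖p.1‖ * ‖mixedComm l‖) := by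
            gcongr
            calc ‖p.1 * mixedComm l - mixedComm l * p.1‖ ≤ ‖p.1‖ * ‖mixedComm l‖ + ‖mixedComm l‖ * ‖p.1‖ :=
                  (norm_sub_le _ _).trans (add_le_add (norm_mul_le _ _) (norm_mul_le _ _))
              _ = 2 * ‖p.1‖ * ‖mixedComm l‖ := by ring
    have hT3 : ‖p.1 * (p.1 * (fl l).sum - (fl l).sum * p.1) - (p.1 * (fl l).sum - (fl l).sum * p.1) * p.1‖
        ≤ 2 * ‖p.1‖ * (2 * ‖p.1‖ * size (fl l)) := by
      calc ‖p.1 * (p.1 * (fl l).sum - (fl l).sum * p.1) - (p.1 * (fl l).sum - (fl l).sum * p.1) * p.1‖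
          ≤ ‖p.1‖ * ‖p.1 * (fl l).sum - (fl l).sum * p.1‖ + ‖p.1 * (fl l).sum - (fl l).sum * p.1‖ * ‖p.1‖ :=
            (norm_sub_le _ _).trans (add_le_add (norm_mul_le _ _) (norm_mul_le _ _))
        _ ≤ ‖p.1‖ * (2 * ‖p.1‖ * size (fl l)) + (2 * ‖p.1‖ * size (fl l)) * ‖p.1‖ := by gcongr
        _ = 2 * ‖p.1‖ * (2 * ‖p.1‖ * size (fl l)) := by ring
    calc ‖mixedJet₂ l + (2 : ℕ) • (p.1 * mixedComm l - mixedComm l * p.1)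
          + (p.1 * (p.1 * (fl l).sum - (fl l).sum * p.1) - (p.1 * (fl l).sum - (fl l).sum * p.1) * p.1)‖
        ≤ ‖mixedJet₂ l‖ + ‖(2 : ℕ) • (p.1 * mixedComm l - mixedComm l * p.1)‖
          + ‖p.1 * (p.1 * (fl l).sum - (fl l).sum * p.1) - (p.1 * (fl l).sum - (fl l).sum * p.1) * p.1‖ :=
          norm_add₃_le
      _ ≤ 4 * size (bg l) ^ 2 * size (fl l) + 2 * (2 * ‖p.1‖ * ‖mixedComm l‖)
          + 2 * ‖p.1‖ * (2 * ‖p.1‖ * size (fl l)) := by gcongr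
      _ ≤ 4 * size (bg l) ^ 2 * size (fl l) + 2 * (2 * ‖p.1‖ * (2 * size (bg l) * size (fl l)))
          + 2 * ‖p.1‖ * (2 * ‖p.1‖ * size (fl l)) := by gcongr
      _ = 4 * (‖p.1‖ + size (bg l)) ^ 2 * size (fl l) := by ring
      _ ≤ 4 * (‖p.1‖ + size (bg l)) ^ 2 * (‖p.2‖ + size (fl l)) := by gcongr; linarith

end Algebra

/-! ## §2–§3  The transported contour sum `(R_{0,y}A)(Γ)` for `V₀ = e^{tB}` and its background jets -/

section Transport

variable (𝕜 : Type*) [RCLike 𝕜] {𝔸 : Type*} [NormedRing 𝔸] [NormedAlgebra 𝕜 𝔸] [CompleteSpace 𝔸]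

/-- [folklore] THE TRANSPORTED CONTOUR SUM `(R_{0,y}A)(Γ)` with background `V₀ = e^{tB}` ((58) with «the product over b
replaced by the sum», p. 28): each fluctuation letter adjoint-transported to the initial point along the preceding
bonds, recursively `transSum ((b,a)::l) t = a + e^{tb}·(transSum l t)·e^{−tb}`. -/
def transSum : List (𝔸 × 𝔸) → 𝕜 → 𝔸
  | [], _ => 0
  | p :: l, t => p.2 + exp (t • p.1) * transSum l t * exp (t • (-p.1))

omit [CompleteSpace 𝔸] in
/-- [folklore] `transSum [] t = 0`. -/
@[simp] theorem transSum_nil (t : 𝕜) : transSum 𝕜 ([] : List (𝔸 × 𝔸)) t = 0 := rfl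

omit [CompleteSpace 𝔸] in
/-- [folklore] The recursion of `transSum`. -/
theorem transSum_cons (p : 𝔸 × 𝔸) (l : List (𝔸 × 𝔸)) (t : 𝕜) :
    transSum 𝕜 (p :: l) t = p.2 + exp (t • p.1) * transSum 𝕜 l t * exp (t • (-p.1)) := rfl

omit [CompleteSpace 𝔸] in
/-- [folklore] AT ZERO BACKGROUND the transported sum is the plain letter sum `Σ_j A_j`. -/
@[simp] theorem transSum_zero (l : List (𝔸 × 𝔸)) : transSum 𝕜 l 0 = (fl l).sum := by
  induction l with
  | nil => simp
  | cons p l ih => simp [transSum_cons, ih]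

/-- [folklore] `e^{tb}·e^{−tb} = 1` (node 3's `holPath_mul_inv` on one bond). -/
@[simp] theorem exp_tsmul_mul_exp_neg (b : 𝔸) (t : 𝕜) : exp (t • b) * exp (-(t • b)) = 1 := by
  have h := holPath_mul_inv 𝕜 [b] t
  simpa [holPath_cons, invPath, smul_neg] using h

/-- [folklore] `e^{−tb}·e^{tb} = 1` (node 3's `holPath_inv_mul` on one bond). -/
@[simp] theorem exp_neg_mul_exp_tsmul (b : 𝔸) (t : 𝕜) : exp (-(t • b)) * exp (t • b) = 1 := by
  have h := holPath_inv_mul 𝕜 [b] t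
  simpa [holPath_cons, invPath, smul_neg] using h

omit [CompleteSpace 𝔸] in
/-- [folklore] CONCATENATED CONTOURS: the letters of the second piece are transported through the whole first piece —
`(R A)(Γ₁ ∪ Γ₂) = (R A)(Γ₁) + Ad_{V₀(Γ₁)} (R A)(Γ₂)` (node 3's `conjPath` along the background letters of `Γ₁`;
B7 (57) «R(X)R(Y) = R(XY)»). -/
theorem transSum_append (l₁ l₂ : List (𝔸 × 𝔸)) (t : 𝕜) :
    transSum 𝕜 (l₁ ++ l₂) t = transSum 𝕜 l₁ t + conjPath 𝕜 (bg l₁) (transSum 𝕜 l₂ t) t := by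
  induction l₁ with
  | nil => simp
  | cons p l₁ ih =>
    simp only [List.cons_append, transSum_cons, ih, bg_cons, conjPath, holPath_cons, holPath_inv_cons, smul_neg]
    noncomm_ring

omit [CompleteSpace 𝔸] in
/-- [folklore] THE PRINTED SHAPE OF (58), one bond at a time: appending a bond `(b, a)` adds its fluctuation letter
transported along the full preceding contour, `(R_{0,y}A)(Γ ∪ b) = (R_{0,y}A)(Γ) + R(V₀(Γ))a` («R(V₀(Γ_{y,b₋}))V′_b»
with the product replaced by the sum). -/
theorem transSum_append_single (l : List (𝔸 × 𝔸)) (p : 𝔸 × 𝔸) (t : 𝕜) :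
    transSum 𝕜 (l ++ [p]) t = transSum 𝕜 l t + conjPath 𝕜 (bg l) p.2 t := by
  rw [transSum_append]
  simp [transSum_cons]

omit [CompleteSpace 𝔸] in
/-- [folklore] NO BACKGROUND ⇒ NO TRANSPORT: if every `B_j = 0` then `(R A)(Γ) = Σ_j A_j` for all `t`. -/
theorem transSum_eq_sum_of_bg (l : List (𝔸 × 𝔸)) (h : ∀ p ∈ l, p.1 = 0) (t : 𝕜) :
    transSum 𝕜 l t = (fl l).sum := by
  induction l with
  | nil => simp
  | cons p l ih =>
    have hp : p.1 = 0 := h p (by simp)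
    have hl : ∀ q ∈ l, q.1 = 0 := fun q hq => h q (by simp [hq])
    simp [transSum_cons, ih hl, hp]

/-- [folklore] TRACIAL FUNCTIONALS DO NOT SEE THE TRANSPORT: `τ((R_{0,y}A)(Γ)) = τ(Σ_j A_j)` for every `t`. -/
theorem trace_transSum {V : Type*} [AddCommGroup V] (τ : 𝔸 →+ V) (hτ : ∀ a b : 𝔸, τ (a * b) = τ (b * a))
    (l : List (𝔸 × 𝔸)) (t : 𝕜) : τ (transSum 𝕜 l t) = τ (fl l).sum := by
  induction l with
  | nil => simp
  | cons p l ih =>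
    rw [transSum_cons, map_add, hτ, ← mul_assoc, smul_neg, exp_neg_mul_exp_tsmul, one_mul, ih, fl_cons,
      List.sum_cons, map_add]

/-- [folklore] First derivative of the transported sum (recursive Leibniz form). -/
def transD₁ : List (𝔸 × 𝔸) → 𝕜 → 𝔸
  | [], _ => 0
  | p :: l, t => (p.1 * exp (t • p.1) * transSum 𝕜 l t + exp (t • p.1) * transD₁ l t) * exp (t • (-p.1))
      + exp (t • p.1) * transSum 𝕜 l t * ((-p.1) * exp (t • (-p.1)))

/-- [folklore] Second derivative of the transported sum (recursive Leibniz form). -/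
def transD₂ : List (𝔸 × 𝔸) → 𝕜 → 𝔸
  | [], _ => 0
  | p :: l, t =>
      ((p.1 * (p.1 * exp (t • p.1)) * transSum 𝕜 l t + p.1 * exp (t • p.1) * transD₁ 𝕜 l t)
          + (p.1 * exp (t • p.1) * transD₁ 𝕜 l t + exp (t • p.1) * transD₂ l t)) * exp (t • (-p.1))
        + (p.1 * exp (t • p.1) * transSum 𝕜 l t + exp (t • p.1) * transD₁ 𝕜 l t) * ((-p.1) * exp (t • (-p.1)))
      + ((p.1 * exp (t • p.1) * transSum 𝕜 l t + exp (t • p.1) * transD₁ 𝕜 l t) * ((-p.1) * exp (t • (-p.1)))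
        + exp (t • p.1) * transSum 𝕜 l t * ((-p.1) * ((-p.1) * exp (t • (-p.1)))))

omit [CompleteSpace 𝔸] in
/-- [folklore] `transD₁ [] t = 0`. -/
@[simp] theorem transD₁_nil (t : 𝕜) : transD₁ 𝕜 ([] : List (𝔸 × 𝔸)) t = 0 := rfl

omit [CompleteSpace 𝔸] in
/-- [folklore] The recursion of `transD₁`. -/
theorem transD₁_cons (p : 𝔸 × 𝔸) (l : List (𝔸 × 𝔸)) (t : 𝕜) :
    transD₁ 𝕜 (p :: l) t = (p.1 * exp (t • p.1) * transSum 𝕜 l t + exp (t • p.1) * transD₁ 𝕜 l t) * exp (t • (-p.1))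
      + exp (t • p.1) * transSum 𝕜 l t * ((-p.1) * exp (t • (-p.1))) := rfl

omit [CompleteSpace 𝔸] in
/-- [folklore] `transD₂ [] t = 0`. -/
@[simp] theorem transD₂_nil (t : 𝕜) : transD₂ 𝕜 ([] : List (𝔸 × 𝔸)) t = 0 := rfl

omit [CompleteSpace 𝔸] in
/-- [folklore] The recursion of `transD₂`. -/
theorem transD₂_cons (p : 𝔸 × 𝔸) (l : List (𝔸 × 𝔸)) (t : 𝕜) :
    transD₂ 𝕜 (p :: l) t =
      ((p.1 * (p.1 * exp (t • p.1)) * transSum 𝕜 l t + p.1 * exp (t • p.1) * transD₁ 𝕜 l t)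
          + (p.1 * exp (t • p.1) * transD₁ 𝕜 l t + exp (t • p.1) * transD₂ 𝕜 l t)) * exp (t • (-p.1))
        + (p.1 * exp (t • p.1) * transSum 𝕜 l t + exp (t • p.1) * transD₁ 𝕜 l t) * ((-p.1) * exp (t • (-p.1)))
      + ((p.1 * exp (t • p.1) * transSum 𝕜 l t + exp (t • p.1) * transD₁ 𝕜 l t) * ((-p.1) * exp (t • (-p.1)))
        + exp (t • p.1) * transSum 𝕜 l t * ((-p.1) * ((-p.1) * exp (t • (-p.1))))) := rfl

/-- [folklore] `t ↦ (R_{0,y}A)(Γ)` (background `e^{tB}`) is differentiable at every `t`, derivative `transD₁ l t`. -/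
theorem hasDerivAt_transSum (l : List (𝔸 × 𝔸)) (t : 𝕜) : HasDerivAt (transSum 𝕜 l) (transD₁ 𝕜 l t) t := by
  induction l with
  | nil =>
    have hfun : transSum 𝕜 ([] : List (𝔸 × 𝔸)) = fun _ => 0 := by funext u; rfl
    rw [hfun]
    simpa using hasDerivAt_const t (0 : 𝔸)
  | cons p l ih =>
    have hfun : transSum 𝕜 (p :: l) = fun u => p.2 + exp (u • p.1) * transSum 𝕜 l u * exp (u • (-p.1)) := by
      funext u; rfl
    rw [hfun]
    have hE : HasDerivAt (fun u : 𝕜 => exp (u • p.1)) (p.1 * exp (t • p.1)) t := hasDerivAt_exp_smul_const' p.1 t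
    have hE' : HasDerivAt (fun u : 𝕜 => exp (u • (-p.1))) ((-p.1) * exp (t • (-p.1))) t :=
      hasDerivAt_exp_smul_const' (-p.1) t
    have h := ((hE.mul ih).mul hE').const_add p.2
    exact h.congr_deriv (by simp only [transD₁_cons, Pi.mul_apply])

/-- [folklore] `transD₁ l` is differentiable at every `t`, derivative `transD₂ l t`. -/
theorem hasDerivAt_transD₁ (l : List (𝔸 × 𝔸)) (t : 𝕜) : HasDerivAt (transD₁ 𝕜 l) (transD₂ 𝕜 l t) t := by
  induction l with
  | nil =>
    have hfun : transD₁ 𝕜 ([] : List (𝔸 × 𝔸)) = fun _ => 0 := by funext u; rfl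
    rw [hfun]
    simpa using hasDerivAt_const t (0 : 𝔸)
  | cons p l ih =>
    have hfun : transD₁ 𝕜 (p :: l) = fun u =>
        (p.1 * exp (u • p.1) * transSum 𝕜 l u + exp (u • p.1) * transD₁ 𝕜 l u) * exp (u • (-p.1))
          + exp (u • p.1) * transSum 𝕜 l u * ((-p.1) * exp (u • (-p.1))) := by
      funext u; rfl
    rw [hfun]
    have hE : HasDerivAt (fun u : 𝕜 => exp (u • p.1)) (p.1 * exp (t • p.1)) t := hasDerivAt_exp_smul_const' p.1 t
    have hE' : HasDerivAt (fun u : 𝕜 => exp (u • (-p.1))) ((-p.1) * exp (t • (-p.1))) t :=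
      hasDerivAt_exp_smul_const' (-p.1) t
    have hP : HasDerivAt (fun u : 𝕜 => p.1 * exp (u • p.1)) (p.1 * (p.1 * exp (t • p.1))) t := hE.const_mul p.1
    have hQ : HasDerivAt (fun u : 𝕜 => (-p.1) * exp (u • (-p.1))) ((-p.1) * ((-p.1) * exp (t • (-p.1)))) t :=
      hE'.const_mul (-p.1)
    have hF := hasDerivAt_transSum 𝕜 l t
    have h1 := (((hP.mul hF).add (hE.mul ih)).mul hE')
    have h2 := ((hE.mul hF).mul hQ)
    have h := h1.add h2
    exact h.congr_deriv (by simp only [transD₂_cons, Pi.mul_apply, Pi.add_apply])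

omit [CompleteSpace 𝔸] in
/-- [folklore] THE FIRST BACKGROUND JET OF THE TRANSPORTED SUM IS THE FIRST-JET WORD:
`(d/dt)|₀ (R_{0,y}A)(Γ) = Σ_{i<j} [B_i, A_j]`. -/
@[simp] theorem transD₁_zero (l : List (𝔸 × 𝔸)) : transD₁ 𝕜 l 0 = mixedComm l := by
  induction l with
  | nil => simp
  | cons p l ih =>
    simp only [transD₁_cons, zero_smul, exp_zero, transSum_zero, ih, mixedComm_cons, one_mul, mul_one]
    noncomm_ring

omit [CompleteSpace 𝔸] in
/-- [folklore] THE SECOND BACKGROUND JET OF THE TRANSPORTED SUM IS THE SECOND-JET WORD. -/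
@[simp] theorem transD₂_zero (l : List (𝔸 × 𝔸)) : transD₂ 𝕜 l 0 = mixedJet₂ l := by
  induction l with
  | nil => simp
  | cons p l ih =>
    simp only [transD₂_cons, zero_smul, exp_zero, transSum_zero, transD₁_zero, ih, mixedJet₂_cons, one_mul,
      mul_one, two_smul]
    noncomm_ring

/-- [folklore] FIRST JET, packaged: `HasDerivAt (R_{0,y}A)(Γ) (Σ_{i<j}[B_i, A_j]) 0`. -/
theorem hasDerivAt_transSum_zero (l : List (𝔸 × 𝔸)) : HasDerivAt (transSum 𝕜 l) (mixedComm l) 0 :=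
  (hasDerivAt_transSum 𝕜 l 0).congr_deriv (transD₁_zero 𝕜 l)

/-- [folklore] SECOND JET, packaged (as the derivative at `0` of the first-derivative function). -/
theorem hasDerivAt_transD₁_zero (l : List (𝔸 × 𝔸)) : HasDerivAt (transD₁ 𝕜 l) (mixedJet₂ l) 0 :=
  (hasDerivAt_transD₁ 𝕜 l 0).congr_deriv (transD₂_zero 𝕜 l)

/-- [folklore] TRANSPORT WITH A MOVING ARGUMENT: `u ↦ Ad_{V₀(Γ)(u)} (X u)` is differentiable (Leibniz over an2's
`hasDerivAt_holPath`), for use when the transported quantity itself depends on the background. -/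
theorem hasDerivAt_conjPath_comp (l : List 𝔸) {X : 𝕜 → 𝔸} {X' : 𝔸} {t : 𝕜} (hX : HasDerivAt X X' t) :
    HasDerivAt (fun u => conjPath 𝕜 l (X u) u)
      (D₁ 𝕜 l t * X t * holPath 𝕜 (invPath l) t + holPath 𝕜 l t * X' * holPath 𝕜 (invPath l) t
        + holPath 𝕜 l t * X t * D₁ 𝕜 (invPath l) t) t := by
  have hfun : (fun u => conjPath 𝕜 l (X u) u) = fun u => holPath 𝕜 l u * X u * holPath 𝕜 (invPath l) u := by
    funext u; rfl
  rw [hfun]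
  have h := ((hasDerivAt_holPath 𝕜 l t).mul hX).mul (hasDerivAt_holPath 𝕜 (invPath l) t)
  exact h.congr_deriv (by simp only [Pi.mul_apply]; noncomm_ring)

omit [CompleteSpace 𝔸] in
/-- [folklore] … and AT `t = 0` its jet is `[ΣB(Γ), X 0] + X′`. -/
theorem conjPath_comp_jet_zero (l : List 𝔸) (X₀ X' : 𝔸) :
    D₁ 𝕜 l 0 * X₀ * holPath 𝕜 (invPath l) 0 + holPath 𝕜 l 0 * X' * holPath 𝕜 (invPath l) 0
        + holPath 𝕜 l 0 * X₀ * D₁ 𝕜 (invPath l) 0 = (l.sum * X₀ - X₀ * l.sum) + X' := by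
  simp only [D₁_zero, sum_inv, holPath_zero, mul_one, one_mul]
  noncomm_ring

end Transport

/-! ## §4  The group-level factorisation `V(Γ) = (R_{0,y}V′)(Γ)·V₀(Γ)` and the linearisation in the fluctuation -/

section Factorisation

variable (𝕜 : Type*) [RCLike 𝕜] {𝔸 : Type*} [NormedRing 𝔸] [NormedAlgebra 𝕜 𝔸] [CompleteSpace 𝔸]

/-- [folklore] THE FULL PARALLEL TRANSPORT `V(Γ)` for `V = V′V₀` bondwise ((55): `V_b = V′_b V_{0,b}`), `V′ = e^{sA}`,
`V₀ = e^{tB}`: `Π_j e^{sA_j} e^{tB_j}`. -/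
def pairHol : List (𝔸 × 𝔸) → 𝕜 → 𝕜 → 𝔸
  | [], _, _ => 1
  | p :: l, s, t => exp (s • p.2) * exp (t • p.1) * pairHol l s t

/-- [folklore] THE TRANSPORTED CONTOUR VARIABLE (58) `(R_{0,y}V′)(Γ) = Π_{b⊂Γ} R(V₀(Γ_{y,b₋}))V′_b`, recursively
`e^{sa} · Ad_{e^{tb}}((R_{0,·}V′)(rest))`. -/
def transHol : List (𝔸 × 𝔸) → 𝕜 → 𝕜 → 𝔸
  | [], _, _ => 1
  | p :: l, s, t => exp (s • p.2) * (exp (t • p.1) * transHol l s t * exp (t • (-p.1)))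

omit [CompleteSpace 𝔸] in
/-- [folklore] `pairHol [] = 1`. -/
@[simp] theorem pairHol_nil (s t : 𝕜) : pairHol 𝕜 ([] : List (𝔸 × 𝔸)) s t = 1 := rfl

omit [CompleteSpace 𝔸] in
/-- [folklore] The recursion of `pairHol`. -/
theorem pairHol_cons (p : 𝔸 × 𝔸) (l : List (𝔸 × 𝔸)) (s t : 𝕜) :
    pairHol 𝕜 (p :: l) s t = exp (s • p.2) * exp (t • p.1) * pairHol 𝕜 l s t := rfl

omit [CompleteSpace 𝔸] in
/-- [folklore] `transHol [] = 1`. -/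
@[simp] theorem transHol_nil (s t : 𝕜) : transHol 𝕜 ([] : List (𝔸 × 𝔸)) s t = 1 := rfl

omit [CompleteSpace 𝔸] in
/-- [folklore] The recursion of `transHol`. -/
theorem transHol_cons (p : 𝔸 × 𝔸) (l : List (𝔸 × 𝔸)) (s t : 𝕜) :
    transHol 𝕜 (p :: l) s t = exp (s • p.2) * (exp (t • p.1) * transHol 𝕜 l s t * exp (t • (-p.1))) := rfl

/-- [folklore] THE FACTORISATION BEHIND (58): `V(Γ) = (R_{0,y}V′)(Γ) · V₀(Γ)` — moving every background factor to the
right past the later fluctuation factors conjugates them by the background holonomy of the prefix. -/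
theorem pairHol_eq_transHol_mul_holPath (l : List (𝔸 × 𝔸)) (s t : 𝕜) :
    pairHol 𝕜 l s t = transHol 𝕜 l s t * holPath 𝕜 (bg l) t := by
  induction l with
  | nil => simp
  | cons p l ih =>
    rw [pairHol_cons, transHol_cons, bg_cons, ih]
    simp only [holPath_cons, smul_neg]
    calc exp (s • p.2) * exp (t • p.1) * (transHol 𝕜 l s t * holPath 𝕜 (bg l) t)
        = exp (s • p.2) * exp (t • p.1) * transHol 𝕜 l s t * 1 * holPath 𝕜 (bg l) t := by noncomm_ring
      _ = exp (s • p.2) * exp (t • p.1) * transHol 𝕜 l s t * (exp (-(t • p.1)) * exp (t • p.1))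
            * holPath 𝕜 (bg l) t := by rw [exp_neg_mul_exp_tsmul]
      _ = exp (s • p.2) * (exp (t • p.1) * transHol 𝕜 l s t * exp (-(t • p.1)))
            * (exp (t • p.1) * holPath 𝕜 (bg l) t) := by noncomm_ring

/-- [folklore] WITHOUT FLUCTUATION the transported variable is `1` … -/
@[simp] theorem transHol_zero_left (l : List (𝔸 × 𝔸)) (t : 𝕜) : transHol 𝕜 l 0 t = 1 := by
  induction l with
  | nil => simp
  | cons p l ih => simp [transHol_cons, ih]

/-- [folklore] … and the full transport is the background holonomy. -/
theorem pairHol_zero_left (l : List (𝔸 × 𝔸)) (t : 𝕜) : pairHol 𝕜 l 0 t = holPath 𝕜 (bg l) t := by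
  rw [pairHol_eq_transHol_mul_holPath, transHol_zero_left, one_mul]

omit [CompleteSpace 𝔸] in
/-- [folklore] WITHOUT BACKGROUND the full transport is the fluctuation holonomy. -/
theorem pairHol_zero_right (l : List (𝔸 × 𝔸)) (s : 𝕜) : pairHol 𝕜 l s 0 = holPath 𝕜 (fl l) s := by
  induction l with
  | nil => simp
  | cons p l ih => simp [pairHol_cons, ih, holPath_cons]

/-- [folklore] THE LINEARISATION IN THE FLUCTUATION («only the product over b is replaced by the sum», p. 28):
`(∂/∂s)|₀ (R_{0,y}e^{sA})(Γ) = (R_{0,y}A)(Γ)` for every background strength `t`. -/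
theorem hasDerivAt_transHol_zero (l : List (𝔸 × 𝔸)) (t : 𝕜) :
    HasDerivAt (fun s => transHol 𝕜 l s t) (transSum 𝕜 l t) 0 := by
  induction l with
  | nil =>
    have hfun : (fun s => transHol 𝕜 ([] : List (𝔸 × 𝔸)) s t) = fun _ => 1 := by funext u; rfl
    rw [hfun]
    simpa using hasDerivAt_const (0 : 𝕜) (1 : 𝔸)
  | cons p l ih =>
    have hfun : (fun s => transHol 𝕜 (p :: l) s t) =
        fun s => exp (s • p.2) * (exp (t • p.1) * transHol 𝕜 l s t * exp (t • (-p.1))) := by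
      funext u; rfl
    rw [hfun]
    have hA : HasDerivAt (fun s : 𝕜 => exp (s • p.2)) (p.2 * exp ((0 : 𝕜) • p.2)) 0 :=
      hasDerivAt_exp_smul_const' p.2 0
    have hI : HasDerivAt (fun s => exp (t • p.1) * transHol 𝕜 l s t * exp (t • (-p.1)))
        (exp (t • p.1) * transSum 𝕜 l t * exp (t • (-p.1))) 0 := (ih.const_mul _).mul_const _
    have h := hA.mul hI
    refine h.congr_deriv ?_
    simp [transSum_cons]

/-- [folklore] HENCE THE LINEARISATION OF THE FULL TRANSPORT: `(∂/∂s)|₀ V(Γ) = (R_{0,y}A)(Γ) · V₀(Γ)`. -/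
theorem hasDerivAt_pairHol_zero (l : List (𝔸 × 𝔸)) (t : 𝕜) :
    HasDerivAt (fun s => pairHol 𝕜 l s t) (transSum 𝕜 l t * holPath 𝕜 (bg l) t) 0 := by
  have hfun : (fun s => pairHol 𝕜 l s t) = fun s => transHol 𝕜 l s t * holPath 𝕜 (bg l) t := by
    funext s; exact pairHol_eq_transHol_mul_holPath 𝕜 l s t
  rw [hfun]
  exact (hasDerivAt_transHol_zero 𝕜 l t).mul_const _

end Factorisation

/-! ## §6  On Bałaban's contours: naturality of the node-5 letter lists, the pair form, `(R_{0,y}A)(Γ_{y,x})` and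
`(R_{0,c₋}A)([x, x′])` -/

section Naturality

variable {d : ℕ} {R R' : Type*} [AddCommGroup R] [AddCommGroup R']

/-- [folklore] Push a one-form forward along an additive map of the coefficients. -/
def mapForm (f : R →+ R') (A : Form1 d R) : Form1 d R' := fun κ x => f (A κ x)

/-- [folklore] `mapForm f A κ x = f (A κ x)`. -/
@[simp] theorem mapForm_apply (f : R →+ R') (A : Form1 d R) (κ : Fin d) (x : Site d) :
    mapForm f A κ x = f (A κ x) := rfl

/-- [folklore] Naturality of `segUp`. -/
theorem segUp_map (f : R →+ R') (A : Form1 d R) (z : Site d) (κ : Fin d) (n : ℕ) :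
    (segUp A z κ n).map f = segUp (mapForm f A) z κ n := by
  simp [segUp, List.map_map, Function.comp_def]

/-- [folklore] Naturality of `segDown` (uses `f(−a) = −f(a)`). -/
theorem segDown_map (f : R →+ R') (A : Form1 d R) (z : Site d) (κ : Fin d) (n : ℕ) :
    (segDown A z κ n).map f = segDown (mapForm f A) z κ n := by
  simp [segDown, List.map_map, Function.comp_def]

/-- [folklore] Naturality of `seg`. -/
theorem seg_map (f : R →+ R') (A : Form1 d R) (z : Site d) (κ : Fin d) (n : ℤ) :
    (seg A z κ n).map f = seg (mapForm f A) z κ n := by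
  unfold seg
  split_ifs
  · exact segUp_map f A z κ _
  · exact segDown_map f A z κ _

/-- [folklore] Naturality of `rev`. -/
theorem rev_map (f : R →+ R') (l : List R) : (rev l).map f = rev (l.map f) := by
  simp [rev, List.map_reverse, List.map_map, Function.comp_def]

/-- [folklore] Naturality of `axialAux`. -/
theorem axialAux_map (f : R →+ R') (A : Form1 d R) (y x : Site d) :
    ∀ m, (axialAux A y x m).map f = axialAux (mapForm f A) y x m
  | 0 => by simp [axialAux]
  | m + 1 => by
    simp only [axialAux, List.map_append, axialAux_map f A y x m]
    split_ifs with h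
    · rw [seg_map]
    · simp

/-- [folklore] Naturality of `axial` (`Γ_{y,x}`). -/
theorem axial_map (f : R →+ R') (A : Form1 d R) (y x : Site d) :
    (axial A y x).map f = axial (mapForm f A) y x :=
  axialAux_map f A y x d

/-- [folklore] Naturality of `gammaC` (`Γ_{c,x}`). -/
theorem gammaC_map (f : R →+ R') (A : Form1 d R) (L : ℕ) (μ : Fin d) (y : Site d) (b : Fin d → ℕ) :
    (gammaC A L μ y b).map f = gammaC (mapForm f A) L μ y b := by
  simp only [gammaC, List.map_append, axial_map, segUp_map, rev_map]

/-- [folklore] Naturality of `loopC` (`Γ_{c,x} ∪ (−c)`). -/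
theorem loopC_map (f : R →+ R') (A : Form1 d R) (L : ℕ) (μ : Fin d) (y : Site d) (b : Fin d → ℕ) :
    (loopC A L μ y b).map f = loopC (mapForm f A) L μ y b := by
  simp only [loopC, List.map_append, gammaC_map, segUp_map, rev_map]

/-- [folklore] THE PAIR FORM: background and fluctuation read along the same contour. -/
def pairForm (B A : Form1 d R) : Form1 d (R × R) := fun κ x => (B κ x, A κ x)

omit [AddCommGroup R] in
/-- [folklore] `pairForm B A κ x = (B κ x, A κ x)`. -/
@[simp] theorem pairForm_apply (B A : Form1 d R) (κ : Fin d) (x : Site d) : pairForm B A κ x = (B κ x, A κ x) := rfl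

/-- [folklore] The first projection of the pair form is the background form. -/
@[simp] theorem mapForm_fst_pairForm (B A : Form1 d R) : mapForm (AddMonoidHom.fst R R) (pairForm B A) = B := by
  funext κ x; rfl

/-- [folklore] The second projection of the pair form is the fluctuation form. -/
@[simp] theorem mapForm_snd_pairForm (B A : Form1 d R) : mapForm (AddMonoidHom.snd R R) (pairForm B A) = A := by
  funext κ x; rfl

/-- [folklore] Background letters of the pair form along `Γ_{y,x}` = letters of `B`. -/
@[simp] theorem bg_axial_pairForm (B A : Form1 d R) (y x : Site d) :
    bg (axial (pairForm B A) y x) = axial B y x := by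
  have h := axial_map (AddMonoidHom.fst R R) (pairForm B A) y x
  rw [mapForm_fst_pairForm] at h
  simpa [bg] using h

/-- [folklore] Fluctuation letters of the pair form along `Γ_{y,x}` = letters of `A`. -/
@[simp] theorem fl_axial_pairForm (B A : Form1 d R) (y x : Site d) :
    fl (axial (pairForm B A) y x) = axial A y x := by
  have h := axial_map (AddMonoidHom.snd R R) (pairForm B A) y x
  rw [mapForm_snd_pairForm] at h
  simpa [fl] using h

/-- [folklore] Background letters of the pair form along a straight segment = letters of `B`. -/
@[simp] theorem bg_segUp_pairForm (B A : Form1 d R) (z : Site d) (κ : Fin d) (n : ℕ) :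
    bg (segUp (pairForm B A) z κ n) = segUp B z κ n := by
  have h := segUp_map (AddMonoidHom.fst R R) (pairForm B A) z κ n
  rw [mapForm_fst_pairForm] at h
  simpa [bg] using h

/-- [folklore] Fluctuation letters of the pair form along a straight segment = letters of `A`. -/
@[simp] theorem fl_segUp_pairForm (B A : Form1 d R) (z : Site d) (κ : Fin d) (n : ℕ) :
    fl (segUp (pairForm B A) z κ n) = segUp A z κ n := by
  have h := segUp_map (AddMonoidHom.snd R R) (pairForm B A) z κ n
  rw [mapForm_snd_pairForm] at h
  simpa [fl] using h

/-- [folklore] Background letters of the pair form along `Γ_{c,x}` = letters of `B`. -/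
@[simp] theorem bg_gammaC_pairForm (B A : Form1 d R) (L : ℕ) (μ : Fin d) (y : Site d) (b : Fin d → ℕ) :
    bg (gammaC (pairForm B A) L μ y b) = gammaC B L μ y b := by
  have h := gammaC_map (AddMonoidHom.fst R R) (pairForm B A) L μ y b
  rw [mapForm_fst_pairForm] at h
  simpa [bg] using h

/-- [folklore] Fluctuation letters of the pair form along `Γ_{c,x}` = letters of `A`. -/
@[simp] theorem fl_gammaC_pairForm (B A : Form1 d R) (L : ℕ) (μ : Fin d) (y : Site d) (b : Fin d → ℕ) :
    fl (gammaC (pairForm B A) L μ y b) = gammaC A L μ y b := by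
  have h := gammaC_map (AddMonoidHom.snd R R) (pairForm B A) L μ y b
  rw [mapForm_snd_pairForm] at h
  simpa [fl] using h

end Naturality

section Lattice

variable (𝕜 : Type*) [RCLike 𝕜] {𝔸 : Type*} [NormedRing 𝔸] [NormedAlgebra 𝕜 𝔸] [CompleteSpace 𝔸]
variable {d : ℕ}

/-- [folklore] `(R_{0,y}A)(Γ_{y,x})` with `V₀ = e^{tB}` — (58) linearised, on node 5's axial contour `Γ_{y,x}`
(base point `y`, end point `x`, in node 5's site coordinates). -/
def transAxial (B A : Form1 d 𝔸) (y x : Site d) (t : 𝕜) : 𝔸 := transSum 𝕜 (axial (pairForm B A) y x) t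

/-- [folklore] `(R_{0,c₋}A)([x, x′])` with `V₀ = e^{tB}` for the coarse bond `c = ⟨y, y + e_μ⟩` and the fine point
`x = L·y + b`, `x′ = x + L e_μ` — LITERALLY the p. 28 shape: the segment letters prefix-transported along `[x, b₋]` and
then along `Γ_{c₋,x}`, i.e. `R(V₀(Γ_{c₋,x}))` applied to the transported segment sum. -/
def transMain (B A : Form1 d 𝔸) (L : ℕ) (μ : Fin d) (y : Site d) (b : Fin d → ℕ) (t : 𝕜) : 𝔸 :=
  conjPath 𝕜 (axial B ((L : ℤ) • y) ((L : ℤ) • y + toSite b))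
    (transSum 𝕜 (segUp (pairForm B A) ((L : ℤ) • y + toSite b) μ L) t) t

omit [CompleteSpace 𝔸] in
/-- [folklore] THE p. 28 DISPLAY AS A CONCATENATION: transporting along `Γ_{c₋,x} ∪ [x, x′]` gives the axial piece plus
the main-term piece, `(R_{0,c₋}A)(Γ_{c₋,x} ∪ [x,x′]) = (R_{0,c₋}A)(Γ_{c₋,x}) + (R_{0,c₋}A)([x, x′])`. -/
theorem transSum_axial_append_segUp (B A : Form1 d 𝔸) (L : ℕ) (μ : Fin d) (y : Site d) (b : Fin d → ℕ) (t : 𝕜) :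
    transSum 𝕜 (axial (pairForm B A) ((L : ℤ) • y) ((L : ℤ) • y + toSite b)
        ++ segUp (pairForm B A) ((L : ℤ) • y + toSite b) μ L) t
      = transAxial 𝕜 B A ((L : ℤ) • y) ((L : ℤ) • y + toSite b) t + transMain 𝕜 B A L μ y b t := by
  rw [transSum_append, bg_axial_pairForm]
  rfl

omit [CompleteSpace 𝔸] in
/-- [folklore] At the flat background `(R_{0,y}A)(Γ_{y,x}) = A(Γ_{y,x})`. -/
@[simp] theorem transAxial_zero (B A : Form1 d 𝔸) (y x : Site d) : transAxial 𝕜 B A y x 0 = (axial A y x).sum := by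
  simp [transAxial]

omit [CompleteSpace 𝔸] in
/-- [folklore] At the flat background `(R_{0,c₋}A)([x, x′]) = A([x, x′])` … -/
@[simp] theorem transMain_zero (B A : Form1 d 𝔸) (L : ℕ) (μ : Fin d) (y : Site d) (b : Fin d → ℕ) :
    transMain 𝕜 B A L μ y b 0 = (segUp A ((L : ℤ) • y + toSite b) μ L).sum := by
  simp [transMain]

omit [CompleteSpace 𝔸] in
/-- [folklore] … so the block sum of the main term (125) at `V₀ = 1` is node 5's straight-contour sum
([Balaban1984PropagatorsI] (1.11); b07's `B7Prop3Flat`: «(124) REDUCES TO ITS FIRST TERM (125)» at the flat background). -/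
theorem sum_transMain_zero (B A : Form1 d 𝔸) (L : ℕ) (μ : Fin d) (y : Site d) :
    ∑ b ∈ box d L, transMain 𝕜 B A L μ y b 0 = straightSum A L μ y := by
  simp [straightSum]

/-- [folklore] THE FIRST `B`-JET OF THE MAIN TERM, bond block by bond block:
`(d/dt)|₀ (R_{0,c₋}A)([x,x′]) = [B(Γ_{c₋,x}), A([x,x′])] + Σ_{i<j⊂[x,x′]} [B_i, A_j]` — the fluctuation on the straight
segment sees the background circulation along the axial contour to `x` and the ordered background letters preceding it
on the segment. -/
theorem hasDerivAt_transMain_zero (B A : Form1 d 𝔸) (L : ℕ) (μ : Fin d) (y : Site d) (b : Fin d → ℕ) :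
    HasDerivAt (transMain 𝕜 B A L μ y b)
      (((axial B ((L : ℤ) • y) ((L : ℤ) • y + toSite b)).sum * (segUp A ((L : ℤ) • y + toSite b) μ L).sum
          - (segUp A ((L : ℤ) • y + toSite b) μ L).sum * (axial B ((L : ℤ) • y) ((L : ℤ) • y + toSite b)).sum)
        + mixedComm (segUp (pairForm B A) ((L : ℤ) • y + toSite b) μ L)) 0 := by
  have hX := hasDerivAt_transSum_zero 𝕜 (segUp (pairForm B A) ((L : ℤ) • y + toSite b) μ L)
  have h := hasDerivAt_conjPath_comp 𝕜 (axial B ((L : ℤ) • y) ((L : ℤ) • y + toSite b)) hX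
  refine h.congr_deriv ?_
  rw [conjPath_comp_jet_zero, transSum_zero, fl_segUp_pairForm]

/-- [folklore] PURE TRACE CHECK: a tracial functional sees neither transport, `τ((R_{0,c₋}A)([x,x′])) = τ(A([x,x′]))`
for every `t`. -/
theorem trace_transMain {V : Type*} [AddCommGroup V] [Module 𝕜 V] (τ : 𝔸 →ₗ[𝕜] V)
    (hτ : ∀ a c : 𝔸, τ (a * c) = τ (c * a)) (B A : Form1 d 𝔸) (L : ℕ) (μ : Fin d) (y : Site d)
    (b : Fin d → ℕ) (t : 𝕜) :
    τ (transMain 𝕜 B A L μ y b t) = τ (segUp A ((L : ℤ) • y + toSite b) μ L).sum := by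
  unfold transMain
  rw [trace_conjPath 𝕜 τ hτ]
  have h := trace_transSum 𝕜 τ.toAddMonoidHom hτ (segUp (pairForm B A) ((L : ℤ) • y + toSite b) μ L) t
  simpa using h

end Lattice

/-! ## §7  Sanity examples -/

section Examples

/-- [folklore] Two bonds: the only ordered pair is `(1,2)`, `mixedComm [(b₁,a₁),(b₂,a₂)] = b₁a₂ − a₂b₁`. -/
example {𝔸 : Type*} [NormedRing 𝔸] (b₁ a₁ b₂ a₂ : 𝔸) : mixedComm [(b₁, a₁), (b₂, a₂)] = b₁ * a₂ - a₂ * b₁ := by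
  simp [fl]

/-- [folklore] Three bonds: the ordered pairs `(1,2), (1,3), (2,3)`. -/
example {𝔸 : Type*} [NormedRing 𝔸] (b₁ a₁ b₂ a₂ b₃ a₃ : 𝔸) :
    mixedComm [(b₁, a₁), (b₂, a₂), (b₃, a₃)]
      = (b₁ * a₂ - a₂ * b₁) + (b₁ * a₃ - a₃ * b₁) + (b₂ * a₃ - a₃ * b₂) := by
  simp only [mixedComm_cons, mixedComm_nil, fl_cons, fl_nil, List.sum_cons, List.sum_nil, add_zero, mul_zero,
    zero_mul, sub_zero, zero_add]
  noncomm_ring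

end Examples

end Literature.MathematicalPhysics.QuantumFieldTheory.Balaban1983to89.Beta.TransportedContourVariables
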